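import Mathlib.Tactic.Linarith
import Mathlib.Tactic.Ring
import Mathlib.Tactic.Positivity
import Mathlib.Tactic.Zify
import Mathlib.Tactic.LinearCombination
import Summits.MatrixMultiplication.OmegaCensus.DicyclicLawModOne
import HarnessLib

/-!
# The shape of a law-attaining size vector, `|A| ≡ 2 (mod 3)`

ω-census, family (b3).  Framing: lottery ticket; floor = certified bounds/negative ranges.

Pure arithmetic behind `DihedralLawAttainedCyclic.lean`.  For the six coset-part sizes `s₀,s₁,t₀,t₁,u₀,u₁` of a TPP
triple of a dihedral-like group over `A` (`|A| = N ≡ 2 (mod 3)`, `N` even, `N ≥ 14`) satisfying the four counting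
constraints and the law `3V + 4 = 8N` (`V = (s₀+s₁)(t₀+t₁)(u₀+u₁) = 4⌊2N/3⌋`): either both sumset triangles tile
(`A₁ = A₂ = N`), or two of the three sets have parts `(1,1)` and the third has parts `((N+1)/3, (N−2)/3)` or
`((N−2)/3, (N+1)/3)` (`parts_law_shape`).  Steps: the A-level classification `parts_mod_two`
(`DicyclicLawModOne.lean`) and Newton's inequalities pin the triangle sums and `(3A₀, 3A₃)` (`law_classes`); then by
Vieta the three parts of the tiling triangle, being the roots of `λ³ − e₁λ² + e₂λ − e₃ = (λ−q−1)²(λ−q)`, are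
`{q+1, q+1, q}` (`root_cases`), which forces the shape (`shape_of_tiling_one`).
-/

namespace Summit.MatrixMultiplication.OmegaCensus

/-- Vieta for one root: `x` is a root of the monic cubic with the elementary symmetric functions of `x, y, z`.
[folklore] -/
theorem vieta_root (x y z : ℤ) : x ^ 3 - (x + y + z) * x ^ 2 + (x * y + y * z + z * x) * x - x * y * z = 0 := by
  ring

/-- If `x + y + z = 3q + 2`, `xy + yz + zx = (q+1)(3q+1)` and `xyz = (q+1)² q` then `x ∈ {q, q+1}`. [folklore] -/
theorem root_cases {x y z q : ℤ} (h1 : x + y + z = 3 * q + 2) (h2 : x * y + y * z + z * x = (q + 1) * (3 * q + 1))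
    (h3 : x * y * z = (q + 1) ^ 2 * q) : x = q + 1 ∨ x = q := by
  have h := vieta_root x y z
  rw [h1, h2, h3] at h
  have hf : (x - (q + 1)) ^ 2 * (x - q) = 0 := by linear_combination h
  rcases mul_eq_zero.1 hf with h | h
  · left; have := pow_eq_zero_iff (n := 2) (by norm_num) |>.1 h; linarith
  · right; linarith

/-- The triangle sums and `(3A₀, 3A₃)` of a law-attaining vector (`3V + 4 = 8N`): both sums `N`, or
`(N, N−1)` with `(3A₀, 3A₃) = (N+1, N−2)`, or the mirror image. [folklore] -/
theorem law_classes (N A₀ B₁ B₂ A₃ : ℤ) (hN : 14 ≤ N)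
    (hN₁ : 3 * A₀ * B₂ ≤ B₁ ^ 2) (hN₂ : 3 * B₁ * A₃ ≤ B₂ ^ 2)
    (q₁ : B₁ ≤ N) (q₂ : B₂ ≤ N) (hA1 : N - 2 ≤ B₁) (hA2 : N - 2 ≤ B₂) (hsum : 2 * N - 2 ≤ B₁ + B₂)
    (eV : 3 * (A₀ + B₁ + B₂ + A₃) + 4 = 8 * N) :
    (B₁ = N ∧ B₂ = N) ∨ (B₁ = N ∧ B₂ = N - 1 ∧ 3 * A₀ = N + 1 ∧ 3 * A₃ = N - 2) ∨
      (B₁ = N - 1 ∧ B₂ = N ∧ 3 * A₀ = N - 2 ∧ 3 * A₃ = N + 1) := by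
  have hB1 : B₁ = N - 2 ∨ B₁ = N - 1 ∨ B₁ = N := by omega
  have hB2 : B₂ = N - 2 ∨ B₂ = N - 1 ∨ B₂ = N := by omega
  rcases hB1 with b1 | b1 | b1 <;> rcases hB2 with b2 | b2 | b2
  · exfalso; linarith only [b1, b2, hsum]
  · exfalso; linarith only [b1, b2, hsum]
  · -- edge `(N-2, N)`
    exfalso
    rw [b1, b2] at hN₁ hN₂
    have u0 : 3 * A₀ ≤ N - 4 := by
      by_contra hc
      have hc' : N - 3 ≤ 3 * A₀ := by omega
      linarith only [mul_le_mul_of_nonneg_right hc' (by linarith only [hN] : (0:ℤ) ≤ N), hN₁, hN]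
    have u3 : 3 * A₃ ≤ N + 2 := by
      by_contra hc
      have hc' : N + 3 ≤ 3 * A₃ := by omega
      linarith only [mul_le_mul_of_nonneg_left hc' (by linarith only [hN] : (0:ℤ) ≤ N - 2), hN₂, hN]
    linarith only [u0, u3, eV, b1, b2]
  · exfalso; linarith only [b1, b2, hsum]
  · exfalso
    rw [b1, b2] at hN₁ hN₂
    have u0 : 3 * A₀ ≤ N - 1 := by
      by_contra hc
      have hc' : N ≤ 3 * A₀ := by omega
      linarith only [mul_le_mul_of_nonneg_right hc' (by linarith only [hN] : (0:ℤ) ≤ N - 1), hN₁, hN]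
    have u3 : 3 * A₃ ≤ N - 1 := by
      by_contra hc
      have hc' : N ≤ 3 * A₃ := by omega
      linarith only [mul_le_mul_of_nonneg_left hc' (by linarith only [hN] : (0:ℤ) ≤ N - 1), hN₂, hN]
    linarith only [u0, u3, eV, b1, b2]
  · right; right
    rw [b1, b2] at hN₁ hN₂
    have u0 : 3 * A₀ ≤ N - 2 := by
      by_contra hc
      have hc' : N - 1 ≤ 3 * A₀ := by omega
      linarith only [mul_le_mul_of_nonneg_right hc' (by linarith only [hN] : (0:ℤ) ≤ N), hN₁, hN]
    have u3 : 3 * A₃ ≤ N + 1 := by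
      by_contra hc
      have hc' : N + 2 ≤ 3 * A₃ := by omega
      linarith only [mul_le_mul_of_nonneg_left hc' (by linarith only [hN] : (0:ℤ) ≤ N - 1), hN₂, hN]
    exact ⟨b1, b2, by linarith only [u0, u3, eV, b1, b2], by linarith only [u0, u3, eV, b1, b2]⟩
  · -- edge `(N, N-2)`
    exfalso
    rw [b1, b2] at hN₁ hN₂
    have u0 : 3 * A₀ ≤ N + 2 := by
      by_contra hc
      have hc' : N + 3 ≤ 3 * A₀ := by omega
      linarith only [mul_le_mul_of_nonneg_right hc' (by linarith only [hN] : (0:ℤ) ≤ N - 2), hN₁, hN]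
    have u3 : 3 * A₃ ≤ N - 4 := by
      by_contra hc
      have hc' : N - 3 ≤ 3 * A₃ := by omega
      linarith only [mul_le_mul_of_nonneg_left hc' (by linarith only [hN] : (0:ℤ) ≤ N), hN₂, hN]
    linarith only [u0, u3, eV, b1, b2]
  · right; left
    rw [b1, b2] at hN₁ hN₂
    have u0 : 3 * A₀ ≤ N + 1 := by
      by_contra hc
      have hc' : N + 2 ≤ 3 * A₀ := by omega
      linarith only [mul_le_mul_of_nonneg_right hc' (by linarith only [hN] : (0:ℤ) ≤ N - 1), hN₁, hN]
    have u3 : 3 * A₃ ≤ N - 2 := by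
      by_contra hc
      have hc' : N - 1 ≤ 3 * A₃ := by omega
      linarith only [mul_le_mul_of_nonneg_left hc' (by linarith only [hN] : (0:ℤ) ≤ N), hN₂, hN]
    exact ⟨b1, b2, by linarith only [u0, u3, eV, b1, b2], by linarith only [u0, u3, eV, b1, b2]⟩
  · left; exact ⟨b1, b2⟩

/-- The shape forced by a tiling first triangle: sizes with `Σ tri₁ = N`, `Σ tri₂ = N − 1`, `3 s₀t₀u₀ = N + 1`,
`3 s₁t₁u₁ = N − 2` have two letters `(1,1)` and the third `((N+1)/3, (N−2)/3)` (Vieta: the parts of triangle 1 are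
the roots of `(λ − q − 1)²(λ − q)`). [folklore] -/
theorem shape_of_tiling_one (N s₀ s₁ t₀ t₁ u₀ u₁ : ℕ) (ps₀ : 0 < s₀) (ps₁ : 0 < s₁) (pt₀ : 0 < t₀) (pt₁ : 0 < t₁)
    (pu₀ : 0 < u₀) (pu₁ : 0 < u₁) (hB1 : s₁ * t₀ * u₀ + s₀ * t₁ * u₀ + s₀ * t₀ * u₁ = N)
    (hB2 : s₀ * t₁ * u₁ + s₁ * t₀ * u₁ + s₁ * t₁ * u₀ + 1 = N) (g0 : 3 * (s₀ * t₀ * u₀) = N + 1)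
    (g3 : 3 * (s₁ * t₁ * u₁) + 2 = N) :
    (s₀ = 1 ∧ s₁ = 1 ∧ t₀ = 1 ∧ t₁ = 1 ∧ 3 * u₀ = N + 1 ∧ 3 * u₁ + 2 = N) ∨
    (s₀ = 1 ∧ s₁ = 1 ∧ u₀ = 1 ∧ u₁ = 1 ∧ 3 * t₀ = N + 1 ∧ 3 * t₁ + 2 = N) ∨
    (t₀ = 1 ∧ t₁ = 1 ∧ u₀ = 1 ∧ u₁ = 1 ∧ 3 * s₀ = N + 1 ∧ 3 * s₁ + 2 = N) := by
  set A₀ : ℤ := (s₀ : ℤ) * t₀ * u₀ with hA₀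
  set A₃ : ℤ := (s₁ : ℤ) * t₁ * u₁ with hA₃
  set X : ℤ := (s₁ : ℤ) * t₀ * u₀ with hX
  set Y : ℤ := (s₀ : ℤ) * t₁ * u₀ with hY
  set Z : ℤ := (s₀ : ℤ) * t₀ * u₁ with hZ
  have e₁ : A₀ * ((s₀ : ℤ) * t₁ * u₁ + (s₁ : ℤ) * t₀ * u₁ + (s₁ : ℤ) * t₁ * u₀) = X * Y + Y * Z + Z * X := by
    simp only [hA₀, hX, hY, hZ]; ring
  have e₃ : X * Y * Z = A₀ ^ 2 * A₃ := by
    simp only [hA₀, hA₃, hX, hY, hZ]; ring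
  have b1 : X + Y + Z = N := by zify at hB1; linarith
  have b2 : (s₀ : ℤ) * t₁ * u₁ + (s₁ : ℤ) * t₀ * u₁ + (s₁ : ℤ) * t₁ * u₀ = N - 1 := by zify at hB2; linarith
  have k0 : 3 * A₀ = N + 1 := by zify at g0; linarith
  have k3 : 3 * A₃ = N - 2 := by zify at g3; linarith
  have hq : A₀ = A₃ + 1 := by linarith
  have r1 : X + Y + Z = 3 * A₃ + 2 := by linarith
  have r2 : X * Y + Y * Z + Z * X = (A₃ + 1) * (3 * A₃ + 1) := by
    rw [← e₁, hq, b2]; congr 1; linarith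
  have r3 : X * Y * Z = (A₃ + 1) ^ 2 * A₃ := by rw [e₃, hq]
  have cX := root_cases r1 r2 r3
  have cY := root_cases (x := Y) (y := Z) (z := X) (q := A₃) (by linarith) (by linarith) (by linarith)
  have cZ := root_cases (x := Z) (y := X) (z := Y) (q := A₃) (by linarith) (by linarith) (by linarith)
  -- cancellation helpers
  have cancel : ∀ {a b c c' : ℕ}, 0 < a → 0 < b → (a : ℤ) * b * c = (a : ℤ) * b * c' → c = c' := by
    intro a b c c' ha hb h
    have h0 : ((a : ℤ) * b) * ((c : ℤ) - c') = 0 := by linear_combination h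
    rcases mul_eq_zero.1 h0 with h1 | h1
    · exact absurd h1 (by positivity)
    · exact_mod_cast (sub_eq_zero.1 h1)
  have unit : ∀ {a b c c' : ℕ}, (a : ℤ) * b * c = (a : ℤ) * b * c' + 1 → a = 1 ∧ b = 1 := by
    intro a b c c' h
    have h0 : ((a * b : ℕ) : ℤ) * ((c : ℤ) - c') = 1 := by push_cast; linear_combination h
    have h1 : ((a * b : ℕ) : ℤ) = 1 := Int.eq_one_of_mul_eq_one_right (by positivity) h0
    have h2 : a * b = 1 := by exact_mod_cast h1
    exact ⟨Nat.eq_one_of_mul_eq_one_right h2, Nat.eq_one_of_mul_eq_one_left h2⟩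
  rcases cX with cX | cX <;> rcases cY with cY | cY <;> rcases cZ with cZ | cZ <;>
    try (exfalso; linarith only [r1, cX, cY, cZ])
  · -- `(q+1, q+1, q)`: `U` big
    left
    have es : s₁ = s₀ := cancel pt₀ pu₀ (by
      have h : X = A₀ := by linarith only [cX, hq]
      rw [hX, hA₀] at h; linear_combination h)
    have et : t₁ = t₀ := cancel ps₀ pu₀ (by
      have h : Y = A₀ := by linarith only [cY, hq]
      rw [hY, hA₀] at h; linear_combination h)
    obtain ⟨hs, ht⟩ : s₀ = 1 ∧ t₀ = 1 := unit (c := u₀) (c' := u₁) (by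
      have h : A₀ = Z + 1 := by linarith only [cZ, hq]
      rw [hZ, hA₀] at h; linear_combination h)
    subst es et hs ht
    refine ⟨rfl, rfl, rfl, rfl, ?_, ?_⟩
    · simp only [Nat.cast_one, one_mul] at hA₀; zify; linarith only [hA₀, k0]
    · simp only [Nat.cast_one, one_mul] at hZ; zify; linarith only [hZ, cZ, k3]
  · -- `(q+1, q, q+1)`: `T` big
    right; left
    have es : s₁ = s₀ := cancel pt₀ pu₀ (by
      have h : X = A₀ := by linarith only [cX, hq]
      rw [hX, hA₀] at h; linear_combination h)
    have eu : u₁ = u₀ := cancel ps₀ pt₀ (by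
      have h : Z = A₀ := by linarith only [cZ, hq]
      rw [hZ, hA₀] at h; linear_combination h)
    obtain ⟨hs, hu⟩ : s₀ = 1 ∧ u₀ = 1 := unit (c := t₀) (c' := t₁) (by
      have h : A₀ = Y + 1 := by linarith only [cY, hq]
      rw [hY, hA₀] at h; linear_combination h)
    subst es eu hs hu
    refine ⟨rfl, rfl, rfl, rfl, ?_, ?_⟩
    · simp only [Nat.cast_one, one_mul, mul_one] at hA₀; zify; linarith only [hA₀, k0]
    · simp only [Nat.cast_one, one_mul, mul_one] at hY; zify; linarith only [hY, cY, k3]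
  · -- `(q, q+1, q+1)`: `S` big
    right; right
    have et : t₁ = t₀ := cancel ps₀ pu₀ (by
      have h : Y = A₀ := by linarith only [cY, hq]
      rw [hY, hA₀] at h; linear_combination h)
    have eu : u₁ = u₀ := cancel ps₀ pt₀ (by
      have h : Z = A₀ := by linarith only [cZ, hq]
      rw [hZ, hA₀] at h; linear_combination h)
    obtain ⟨ht, hu⟩ : t₀ = 1 ∧ u₀ = 1 := unit (c := s₀) (c' := s₁) (by
      have h : A₀ = X + 1 := by linarith only [cX, hq]
      rw [hX, hA₀] at h; linear_combination h)
    subst et eu ht hu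
    refine ⟨rfl, rfl, rfl, rfl, ?_, ?_⟩
    · simp only [Nat.cast_one, mul_one] at hA₀; zify; linarith only [hA₀, k0]
    · simp only [Nat.cast_one, mul_one] at hX; zify; linarith only [hX, cX, k3]

/-- **Shape of a law-attaining size vector, `N ≡ 2 (mod 3)`.**  With the part sizes `s₀,…,u₁` of a TPP triple of a
dihedral-like group over `A`, `|A| = N ≡ 2 (mod 3)` even, `N ≥ 14`, the four counting constraints and
`3V + 4 = 8N` (the law `V = 4⌊2N/3⌋`): either both triangles tile (`A₁ = A₂ = N`, excluded later by
`three_dvd_of_double_tiling'`), or two of the three sets have parts `(1,1)` and the third has parts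
`((N+1)/3, (N−2)/3)` (tiling triangle 1) or `((N−2)/3, (N+1)/3)` (tiling triangle 2). [folklore] -/
theorem parts_law_shape (N s₀ s₁ t₀ t₁ u₀ u₁ : ℕ) (hmod : N % 3 = 2) (heven : N % 2 = 0) (hN : 14 ≤ N)
    (h₀ : s₀ * t₀ * u₀ ≤ N) (h₃ : s₁ * t₁ * u₁ ≤ N)
    (h₁ : s₁ * t₀ * u₀ + s₀ * t₁ * u₀ + s₀ * t₀ * u₁ ≤ N)
    (h₂ : s₀ * t₁ * u₁ + s₁ * t₀ * u₁ + s₁ * t₁ * u₀ ≤ N)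
    (hV : 3 * ((s₀ + s₁) * (t₀ + t₁) * (u₀ + u₁)) + 4 = 8 * N) :
    (1 ≤ s₀ * t₀ * u₀ ∧ 1 ≤ s₁ * t₁ * u₁ ∧ s₁ * t₀ * u₀ + s₀ * t₁ * u₀ + s₀ * t₀ * u₁ = N ∧
      s₀ * t₁ * u₁ + s₁ * t₀ * u₁ + s₁ * t₁ * u₀ = N) ∨
    (s₀ = 1 ∧ s₁ = 1 ∧ t₀ = 1 ∧ t₁ = 1 ∧
      ((3 * u₀ = N + 1 ∧ 3 * u₁ + 2 = N) ∨ (3 * u₀ + 2 = N ∧ 3 * u₁ = N + 1))) ∨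
    (s₀ = 1 ∧ s₁ = 1 ∧ u₀ = 1 ∧ u₁ = 1 ∧
      ((3 * t₀ = N + 1 ∧ 3 * t₁ + 2 = N) ∨ (3 * t₀ + 2 = N ∧ 3 * t₁ = N + 1))) ∨
    (t₀ = 1 ∧ t₁ = 1 ∧ u₀ = 1 ∧ u₁ = 1 ∧
      ((3 * s₀ = N + 1 ∧ 3 * s₁ + 2 = N) ∨ (3 * s₀ + 2 = N ∧ 3 * s₁ = N + 1))) := by
  obtain ⟨hA0, hA3, hA1, hA2, hsum, hedge2, hedge1⟩ :=
    parts_mod_two N s₀ s₁ t₀ t₁ u₀ u₁ hmod heven hN h₀ h₃ h₁ h₂ (by omega)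
  -- positivity of all six sizes
  have ps₀ : 0 < s₀ := Nat.pos_of_ne_zero fun h => by simp [h] at hA0
  have pt₀ : 0 < t₀ := Nat.pos_of_ne_zero fun h => by simp [h] at hA0
  have pu₀ : 0 < u₀ := Nat.pos_of_ne_zero fun h => by simp [h] at hA0
  have ps₁ : 0 < s₁ := Nat.pos_of_ne_zero fun h => by simp [h] at hA3
  have pt₁ : 0 < t₁ := Nat.pos_of_ne_zero fun h => by simp [h] at hA3
  have pu₁ : 0 < u₁ := Nat.pos_of_ne_zero fun h => by simp [h] at hA3
  -- integer bookkeeping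
  set A₀ : ℤ := (s₀ : ℤ) * t₀ * u₀ with hA₀
  set A₃ : ℤ := (s₁ : ℤ) * t₁ * u₁ with hA₃
  set X : ℤ := (s₁ : ℤ) * t₀ * u₀ with hX
  set Y : ℤ := (s₀ : ℤ) * t₁ * u₀ with hY
  set Z : ℤ := (s₀ : ℤ) * t₀ * u₁ with hZ
  set X' : ℤ := (s₀ : ℤ) * t₁ * u₁ with hX'
  set Y' : ℤ := (s₁ : ℤ) * t₀ * u₁ with hY'
  set Z' : ℤ := (s₁ : ℤ) * t₁ * u₀ with hZ'
  have e₁ : A₀ * (X' + Y' + Z') = X * Y + Y * Z + Z * X := by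
    simp only [hA₀, hX, hY, hZ, hX', hY', hZ']; ring
  have e₂ : (X + Y + Z) * A₃ = X' * Y' + Y' * Z' + Z' * X' := by
    simp only [hA₃, hX, hY, hZ, hX', hY', hZ']; ring
  have e₃ : X * Y * Z = A₀ ^ 2 * A₃ := by
    simp only [hA₀, hA₃, hX, hY, hZ]; ring
  have e₃' : X' * Y' * Z' = A₃ ^ 2 * A₀ := by
    simp only [hA₀, hA₃, hX', hY', hZ']; ring
  have hN₁ : 3 * A₀ * (X' + Y' + Z') ≤ (X + Y + Z) ^ 2 := by
    linarith [e₁, sq_nonneg (X - Y), sq_nonneg (Y - Z), sq_nonneg (Z - X)]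
  have hN₂ : 3 * (X + Y + Z) * A₃ ≤ (X' + Y' + Z') ^ 2 := by
    linarith [e₂, sq_nonneg (X' - Y'), sq_nonneg (Y' - Z'), sq_nonneg (Z' - X')]
  have eV : 3 * (A₀ + (X + Y + Z) + (X' + Y' + Z') + A₃) + 4 = 8 * (N : ℤ) := by
    have : ((3 * ((s₀ + s₁) * (t₀ + t₁) * (u₀ + u₁)) + 4 : ℕ) : ℤ) = 8 * (N : ℤ) := by exact_mod_cast hV
    rw [← this]; simp only [hA₀, hA₃, hX, hY, hZ, hX', hY', hZ']; push_cast; ring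
  have qA1 : (N : ℤ) - 2 ≤ X + Y + Z := by zify at hA1; linarith
  have qA2 : (N : ℤ) - 2 ≤ X' + Y' + Z' := by zify at hA2; linarith
  have q₁ : X + Y + Z ≤ N := by zify at h₁; linarith
  have q₂ : X' + Y' + Z' ≤ N := by zify at h₂; linarith
  have hA0' : (1 : ℤ) ≤ A₀ := by zify at hA0; linarith
  have hA3' : (1 : ℤ) ≤ A₃ := by zify at hA3; linarith
  have qsum : 2 * (N : ℤ) - 2 ≤ (X + Y + Z) + (X' + Y' + Z') := by zify at hsum; linarith
  have hNpos : (14 : ℤ) ≤ N := by exact_mod_cast hN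
  rcases law_classes N A₀ (X + Y + Z) (X' + Y' + Z') A₃ hNpos hN₁ hN₂ q₁ q₂ qA1 qA2 qsum eV with
    ⟨b1, b2⟩ | ⟨b1, b2, g0, g3⟩ | ⟨b1, b2, g0, g3⟩
  · left
    exact ⟨hA0, hA3, by zify; linarith only [b1, hX, hY, hZ], by zify; linarith only [b2, hX', hY', hZ']⟩
  · right
    have := shape_of_tiling_one N s₀ s₁ t₀ t₁ u₀ u₁ ps₀ ps₁ pt₀ pt₁ pu₀ pu₁ (by zify; linarith only [b1, hX, hY, hZ])
      (by zify; linarith only [b2, hX', hY', hZ']) (by zify; linarith only [g0, hA₀]) (by zify; linarith only [g3, hA₃])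
    rcases this with h | h | h
    · exact Or.inl ⟨h.1, h.2.1, h.2.2.1, h.2.2.2.1, Or.inl ⟨h.2.2.2.2.1, h.2.2.2.2.2⟩⟩
    · exact Or.inr (Or.inl ⟨h.1, h.2.1, h.2.2.1, h.2.2.2.1, Or.inl ⟨h.2.2.2.2.1, h.2.2.2.2.2⟩⟩)
    · exact Or.inr (Or.inr ⟨h.1, h.2.1, h.2.2.1, h.2.2.2.1, Or.inl ⟨h.2.2.2.2.1, h.2.2.2.2.2⟩⟩)
  · right
    -- the mirror image: swap the two cosets in every letter
    have := shape_of_tiling_one N s₁ s₀ t₁ t₀ u₁ u₀ ps₁ ps₀ pt₁ pt₀ pu₁ pu₀ (by zify; linarith only [b2, hX', hY', hZ'])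
      (by zify; linarith only [b1, hX, hY, hZ]) (by zify; linarith only [g3, hA₃]) (by zify; linarith only [g0, hA₀])
    rcases this with h | h | h
    · exact Or.inl ⟨h.2.1, h.1, h.2.2.2.1, h.2.2.1, Or.inr ⟨h.2.2.2.2.2, h.2.2.2.2.1⟩⟩
    · exact Or.inr (Or.inl ⟨h.2.1, h.1, h.2.2.2.1, h.2.2.1, Or.inr ⟨h.2.2.2.2.2, h.2.2.2.2.1⟩⟩)
    · exact Or.inr (Or.inr ⟨h.2.1, h.1, h.2.2.2.1, h.2.2.1, Or.inr ⟨h.2.2.2.2.2, h.2.2.2.2.1⟩⟩)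

end Summit.MatrixMultiplication.OmegaCensus
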